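import Literature.NumberTheory.EllipticCurves.DivisionFieldRamificationPrimePowProofs
import Literature.NumberTheory.EllipticCurves.SwanConductorTorsionProofs
import Literature.NumberTheory.GaloisRepresentations.RamificationFiltrationProofs
import HarnessLib

/-!
# Division fields at multiplicative places are TAMELY ramified: the wild ramification groups act
# trivially on `E[n]`, `v ∤ n` ([IUTchIV] Prop. 1.8 (vii), final sentence, the word "tamely")

`Proofs` file (theorems only: no definition, no named fact), topic `NumberTheory/EllipticCurves`;
sequel of `DivisionFieldRamificationPrimePowProofs` (`#ρ̄_{E,n}(I_𝔓) ∣ n`, `e(Q ∣ v) ∣ n`).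

S. Mochizuki, *Inter-universal Teichmüller theory IV*, Prop. 1.8 (vii), kurims p. 19 l. 41–44, final
sentence of (vii) (the third: set-up · good reduction · bad multiplicative reduction):
"If `E_k` has bad multiplicative reduction over `O_k` [i.e., extends to a non-proper semi-abelian scheme
over `O_k`], then the kernel of the action of `G_k` on `E_k[n]` determines a tamely ramified extension of
`k` whose ramification index over `k` divides `n`." (`n` invertible in `O_k`, from the set-up sentence of
(vii)).  The tree's interface `Literature.IUT.LogVolume.Prop18.TorsionSetting.P18_vii`
transcribes "tamely ramified" as "the wild inertia subgroup acts trivially on `E_k[n]`".  GLOBAL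
number-field form, in the Galois group: for `E/K` elliptic over a number field, `v` a finite place of
multiplicative reduction, `n` with `(n : 𝓞 K) ∉ v`, `𝔓 ∣ v` a prime of `\bar ℤ_K` and `u > 0`, the upper
ramification group `Γ_K^u(𝔓)` (`absUpperRamificationSubgroup`; `u > 0` = wild) acts trivially on `E[n]`:

* `WeierstrassCurve.index_ker_galoisRepTorsion_subgroupOf_inertia_dvd` — the index clause in the form
  `[I_𝔓 : I_𝔓 ∩ ker ρ̄_{E,n}] ∣ n` used by the interface `P18_vii`;
* `WeierstrassCurve.natCard_map_absUpperRamificationSubgroup_galoisRepTorsion_eq_one` — the image of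
  `Γ_K^u(𝔓)` in `Aut(E[n])` is trivial: it is contained in the image of `I_𝔓`
  (`absUpperRamificationSubgroup_le_inertia_holds`), which has order dividing `n`
  (`natCard_map_inertia_galoisRepTorsion_dvd`), and its order is prime to every prime `ℓ ∣ n`
  (`coprime_card_map_toAddAut_absUpperRamificationSubgroup`: a `p`-group, `p = char(𝓞 K / v) ∤ n`);
* `WeierstrassCurve.map_absUpperRamificationSubgroup_galoisRepTorsion_eq_bot` — the same as `= ⊥`;
* **`WeierstrassCurve.smul_geomTorsion_eq_of_mem_absUpperRamificationSubgroup`** — `σ P = P` for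
  `σ ∈ Γ_K^u(𝔓)`, `P ∈ E[n]`.

With `ramificationIdx_divisionField_dvd_level_of_hasMultiplicativeReductionAt` (`e ∣ n`) this is the
full printed clause.  Classical (Silverman *ATAEC* V.4–V.5, Ex. 5.13 (b); Serre, *Local Fields* IV §2
Cor. 3 of Prop. 7); cell abc-iut, campaign S, node IUTchIV:Prop1.8(vii); nothing here bears on
[IUTchIII] Cor. 3.12.

## References

* [SilvermanATAEC1994] J. H. Silverman, *Advanced Topics in the Arithmetic of Elliptic Curves* (1994),
  V.4–V.5, Exercise 5.13 (b); Lemma IV.10.1 (d).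
* [SerreLocalFields1979] J.-P. Serre, *Local Fields* (1979), Ch. IV §2, Cor. 3 of Prop. 7.
* [Mochizuki2012] S. Mochizuki, *Inter-universal Teichmüller theory IV*, Prop. 1.8 (vii) p. 19.
-/

noncomputable section

open scoped NumberField

open NumberField IsDedekindDomain Field

universe u

namespace WeierstrassCurve

open Literature.NumberTheory.EllipticCurves Literature.NumberTheory.GaloisRepresentations
  IsDedekindDomain.HeightOneSpectrum

variable {K : Type u} [Field K] [NumberField K] (W : WeierstrassCurve K) [W.IsElliptic]

/-- **The ramification-index clause of [IUTchIV] Prop. 1.8 (vii) in the Galois group**: at a place `v` of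
multiplicative reduction, for `n` with `(n : 𝓞 K) ∉ v` and a prime `𝔓 ∣ v` of `\bar ℤ_K`, the index of
`ker ρ̄_{E,n} ∩ I_𝔓` in the inertia group `I_𝔓` divides `n` — the form
"`(ker.subgroupOf inertia).index ∣ n`" in which the interface
`Literature.IUT.LogVolume.Prop18.TorsionSetting.P18_vii` transcribes "ramification index over `k`
divides `n`" (`natCard_map_inertia_galoisRepTorsion_dvd` and `#f(H) = [H : H ∩ ker f]`).
[cite: Mochizuki2012, IUTchIV Prop 1.8 (vii) p.19] [cite: SilvermanATAEC1994, V.4–V.5 and Exercise 5.13 (b)] -/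
theorem index_ker_galoisRepTorsion_subgroupOf_inertia_dvd {n : ℕ}
    {v : HeightOneSpectrum (𝓞 K)} (hv : W.HasMultiplicativeReductionAt v) (hnv : (n : 𝓞 K) ∉ v.asIdeal)
    {𝔓 : Ideal (absIntegers (𝓞 K) K)} (h𝔓 : 𝔓 ∈ v.primesAbove) :
    ((W.galoisRepTorsion (n : ℤ)).ker.subgroupOf (𝔓.inertia (absoluteGaloisGroup K))).index ∣ n := by
  rw [← natCard_map_eq_index_subgroupOf]
  exact W.natCard_map_inertia_galoisRepTorsion_dvd hv hnv h𝔓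

/-- **The wild ramification groups have trivial image in `Aut(E[n])` at a multiplicative place
`v ∤ n`**: for `u > 0` the image of `Γ_K^u(𝔓)` under `ρ̄_{E,n}` has order `d` with `d ∣ n`
(`Γ_K^u(𝔓) ≤ I_𝔓`, `#ρ̄_{E,n}(I_𝔓) ∣ n`) and `d` coprime to every prime `ℓ ∣ n` (a `p`-group,
`p ∤ n`), so `d = 1`. [cite: SilvermanATAEC1994, V.4–V.5 and Exercise 5.13 (b); Lemma IV.10.1 (d)]
[cite: SerreLocalFields1979, Ch. IV §2 Cor. 3 of Prop. 7] -/
theorem natCard_map_absUpperRamificationSubgroup_galoisRepTorsion_eq_one {n : ℕ}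
    {v : HeightOneSpectrum (𝓞 K)} (hv : W.HasMultiplicativeReductionAt v) (hnv : (n : 𝓞 K) ∉ v.asIdeal)
    {𝔓 : Ideal (absIntegers (𝓞 K) K)} (h𝔓 : 𝔓 ∈ v.primesAbove) {u : ℝ} (hu : 0 < u) :
    Nat.card ((absUpperRamificationSubgroup (𝓞 K) 𝔓 u).map (W.galoisRepTorsion (n : ℤ))) = 1 := by
  have hn : n ≠ 0 := by
    rintro rfl
    exact hnv (by rw [Nat.cast_zero]; exact v.asIdeal.zero_mem)
  set d := Nat.card ((absUpperRamificationSubgroup (𝓞 K) 𝔓 u).map (W.galoisRepTorsion (n : ℤ)))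
    with hd
  -- `d ∣ n`: the wild group sits inside the inertia group
  have hle : (absUpperRamificationSubgroup (𝓞 K) 𝔓 u).map (W.galoisRepTorsion (n : ℤ)) ≤
      (𝔓.inertia (absoluteGaloisGroup K)).map (W.galoisRepTorsion (n : ℤ)) :=
    Subgroup.map_mono (absUpperRamificationSubgroup_le_inertia_holds (𝓞 K) 𝔓 u)
  have hdvd : d ∣ n :=
    (Subgroup.card_dvd_of_le hle).trans (W.natCard_map_inertia_galoisRepTorsion_dvd hv hnv h𝔓)
  -- `d` is coprime to every prime factor of `n`
  have hcop : ∀ ℓ : ℕ, ℓ.Prime → ℓ ∣ n → d.Coprime ℓ := by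
    intro ℓ hℓ hℓn
    haveI : Fact ℓ.Prime := ⟨hℓ⟩
    have hℓv : (ℓ : 𝓞 K) ∉ v.asIdeal := by
      intro h
      obtain ⟨m, rfl⟩ := hℓn
      apply hnv
      rw [Nat.cast_mul]
      exact v.asIdeal.mul_mem_right _ h
    exact W.coprime_card_map_toAddAut_absUpperRamificationSubgroup ℓ hℓv h𝔓 hu hn
  -- hence `d = 1`
  by_contra hd1
  obtain ⟨ℓ, hℓ, hℓd⟩ := Nat.exists_prime_and_dvd hd1
  exact hℓ.ne_one ((hcop ℓ hℓ (hℓd.trans hdvd)).symm.eq_one_of_dvd hℓd)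

/-- **The wild ramification groups map to `⊥` in `Aut(E[n])`** (`v` multiplicative, `v ∤ n`, `u > 0`).
[cite: SilvermanATAEC1994, V.4–V.5 and Exercise 5.13 (b)] [cite: SerreLocalFields1979, Ch. IV §2 Cor. 3 of Prop. 7] -/
theorem map_absUpperRamificationSubgroup_galoisRepTorsion_eq_bot {n : ℕ}
    {v : HeightOneSpectrum (𝓞 K)} (hv : W.HasMultiplicativeReductionAt v) (hnv : (n : 𝓞 K) ∉ v.asIdeal)
    {𝔓 : Ideal (absIntegers (𝓞 K) K)} (h𝔓 : 𝔓 ∈ v.primesAbove) {u : ℝ} (hu : 0 < u) :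
    (absUpperRamificationSubgroup (𝓞 K) 𝔓 u).map (W.galoisRepTorsion (n : ℤ)) = ⊥ :=
  Subgroup.eq_bot_of_card_eq _
    (W.natCard_map_absUpperRamificationSubgroup_galoisRepTorsion_eq_one hv hnv h𝔓 hu)

/-- **[IUTchIV] Prop. 1.8 (vii), final sentence, the word "tamely": at a place `v` of multiplicative
reduction the wild ramification groups `Γ_K^u(𝔓)` (`𝔓 ∣ v`, `u > 0`) act trivially on `E[n]` for every
`n` with `(n : 𝓞 K) ∉ v`** — so the extension of `K` cut out by `ker ρ̄_{E,n}` is tamely ramified at `v`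
(and its ramification index divides `n`: `ramificationIdx_divisionField_dvd_level_of_hasMultiplicativeReductionAt`).
[cite: Mochizuki2012, IUTchIV Prop 1.8 (vii) p.19] [cite: SilvermanATAEC1994, V.4–V.5 and Exercise 5.13 (b)]
[cite: SerreLocalFields1979, Ch. IV §2 Cor. 3 of Prop. 7] -/
theorem smul_geomTorsion_eq_of_mem_absUpperRamificationSubgroup {n : ℕ}
    {v : HeightOneSpectrum (𝓞 K)} (hv : W.HasMultiplicativeReductionAt v) (hnv : (n : 𝓞 K) ∉ v.asIdeal)
    {𝔓 : Ideal (absIntegers (𝓞 K) K)} (h𝔓 : 𝔓 ∈ v.primesAbove) {u : ℝ} (hu : 0 < u)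
    {σ : absoluteGaloisGroup K} (hσ : σ ∈ absUpperRamificationSubgroup (𝓞 K) 𝔓 u)
    (P : geomTorsion W (n : ℤ)) : σ • P = P := by
  have hmem : W.galoisRepTorsion (n : ℤ) σ ∈
      (absUpperRamificationSubgroup (𝓞 K) 𝔓 u).map (W.galoisRepTorsion (n : ℤ)) := ⟨σ, hσ, rfl⟩
  rw [W.map_absUpperRamificationSubgroup_galoisRepTorsion_eq_bot hv hnv h𝔓 hu, Subgroup.mem_bot] at hmem
  rw [← galoisRepTorsion_apply, hmem]
  rfl

/-- The same for points of `E(K̄)`: `σ P = P` whenever `n P = O`, `σ ∈ Γ_K^u(𝔓)`, `u > 0`,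
`v` multiplicative with `(n : 𝓞 K) ∉ v`. [cite: Mochizuki2012, IUTchIV Prop 1.8 (vii) p.19]
[cite: SilvermanATAEC1994, V.4–V.5 and Exercise 5.13 (b)] -/
theorem smul_eq_of_mem_absUpperRamificationSubgroup_of_nsmul_eq_zero {n : ℕ}
    {v : HeightOneSpectrum (𝓞 K)} (hv : W.HasMultiplicativeReductionAt v) (hnv : (n : 𝓞 K) ∉ v.asIdeal)
    {𝔓 : Ideal (absIntegers (𝓞 K) K)} (h𝔓 : 𝔓 ∈ v.primesAbove) {u : ℝ} (hu : 0 < u)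
    {σ : absoluteGaloisGroup K} (hσ : σ ∈ absUpperRamificationSubgroup (𝓞 K) 𝔓 u)
    {P : geomPoints W} (hP : n • P = 0) : σ • P = P := by
  have hmem : P ∈ geomTorsion W (n : ℤ) :=
    (Submodule.mem_torsionBy_iff _ _).mpr (by rw [natCast_zsmul]; exact hP)
  have h := W.smul_geomTorsion_eq_of_mem_absUpperRamificationSubgroup hv hnv h𝔓 hu hσ ⟨P, hmem⟩
  exact congrArg Subtype.val h

end WeierstrassCurve

end
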